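/-
Copyright (c) 2026 the pub-hodgecm-mathlib formalisation cell (harness21).  Prover seat hodgecm-mathlib-F0P2-p02 (g12), 2026-09-01.  «S3-ram» seeding wave (LEAD F0P3a-plan (g12)
T11-41; desk F0P3a-p06 (g15), row «type-(2)-disc-ram»): the tame-RAMIFIED twin of ★ `LocalIrreducibleTorusDiscriminantOdd` (B-p14 (g30) ∕ F0P3b lineage).
-/
import Literature.NumberTheory.Rogawski1990.LocalIrreducibleTorusDiscriminantOdd   -- ★ the inert organ: §1 `sq_mul_trace_sq_sub_four_mul_det_eq_of_kappa_sq`; brings ★ B-p14 `exists_kappa_sq_eq_toLocalRing`, `not_isSquare_of_kappa`, `cmQuadraticGenerator_spec`, `local_eq_unitaryGroupOfForm_map`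
import Literature.NumberTheory.Automorphic.RamifiedPlaceEisensteinBasis             -- ★ `valued_toPlace_eq_sq_of_ramified` (`|ι_v y|_w = |y|_v²` at a ramified `w`)
import Literature.NumberTheory.Automorphic.TypeTwoMoebiusShiftValued               -- ★ γ₁ `exists_isRoot_charpoly_iff_isSquare_disc`
import Literature.NumberTheory.Automorphic.HyperspecialUnitaryCartanAdicCompletion  -- ★ `exists_sq_eq_of_valued_sub_one_lt` (Hensel square roots at `|2|_w = 1`)
import HarnessLib

/-!
# The discriminant of the irreducible unitary `2 × 2` block has EVEN order and is a NON-SQUARE at a tame-ramified place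
# (Rogawski 1990, §3.6 p. 31: the tori `T ≃ (EK)¹`; at a ramified `w` the eigen-field `EK_w ∕ E_w` is UNRAMIFIED)

Topic `NumberTheory/Rogawski1990`; namespace `Literature.NumberTheory.Rogawski1990`.  THEOREMS ONLY (no definition, no instance, no notation, no named fact, no `sorry`;
count-neutral); kernel lane `--supports stmt-HodgeConjecture-24833`.  Cell `pub/hodgecm-mathlib`, crux H413; «S3-ram» seeding wave (LEAD F0P3a-plan (g12) T11-41, desk
F0P3a-p06 (g15) `S3RAM-ORGANS.md` row «type-(2)-disc-ram»; F0P2-p02 (g12)'s bus note 2026-09-01T21:43:52Z, A-p19 (g26) «=» 21:47:57Z).  The TAME-RAMIFIED twin of ★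
`exists_valued_disc_eq_exp_neg_odd_of_not_exists_isRoot` (inert: ODD order, binds `hunr`): consumers = the type-(2) population guard of the ramified `_le_one` clauses
(A-p12 (g23) (α₂) P-2-ram; A-p19 (g26) (e2)(b) [T2-c]-ram «`M = L_w(√ε)` unramified over the ramified base»).  HONEST LABEL: HC_CM is proved only modulo the 2 remaining named
inputs (hLiu418 24832, h413 24833) until rung 0 closes; nothing printed is asserted here.

THE MATHEMATICS.  `γ_H = (g, u) ∈ H_v` at a non-split place `v` of `L⁺` (`σ • w = w`) which is RAMIFIED in the CM field `L` (`e(w|v) = 2`), `χ_{g,w}` without a root in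
`L_w = E_v`.  ★ B-p14 `exists_kappa_sq_eq_toLocalRing` (place-generic at non-split `v`): `E_v[g] ∋ κ = α₀ + β₀ g`, `β₀ ≠ 0`, `κ² = ι_v(k)`, `k ∈ L⁺_v`, `ι_v(k)` a NON-SQUARE in
`E_v`; Cayley–Hamilton gives `β₀² · disc χ_g = 4 ι_v(k)` (★ §1 of the inert file).  At a RAMIFIED `w` every element of `ι_w(L⁺_v)` has EVEN order: `|ι_w k|_w = |k|_v²` (★
`valued_toPlace_eq_sq_of_ramified`), so `ord_w disc χ_{g,w} = 2 ord_v k − 2 ord_w β₀` is EVEN, `= −2N` for integral `tr g_w, det g_w`; and `disc` is not a square since `χ_{g,w}`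
is rootless (`2 ≠ 0`, ★ `exists_isRoot_charpoly_iff_isSquare_disc`) — so its unit part is a non-square unit and the splitting field `L_w(√disc)` is the UNRAMIFIED quadratic
extension of `L_w`: at a ramified place there is no «odd-order» type-(2) population (compare the inert ★ organ, where the order is always odd).  Torus-theoretically: type (2)
↔ a quadratic `K′ ≠ L_w` of `K = L⁺_v`, `disc ≡ d (mod (L_w^×)²)` for `K′ = K(√d)`; with `L_w = K(√ϖ)` the two choices `K′ = K(√ε), K(√εϖ)` both give `d ≡ ε`.

* `exists_valued_disc_eq_exp_neg_even_of_not_exists_isRoot_ramified` — `∃ N : ℕ, |tr² g_w − 4 det g_w|_w = exp(−2N)`, and `¬ IsSquare (tr² g_w − 4 det g_w)`.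

## References
* [Rogawski1990] J. D. Rogawski, *Automorphic Representations of Unitary Groups in Three Variables*, Ann. of Math. Stud. 123 (1990), §3.6 p. 31 (the tori `T ≃ (EK)¹`).
* [Flicker1998UnitaryFL] Y. Z. Flicker, *Elementary proof of the fundamental lemma for a unitary group*, Canad. J. Math. 50 (1998), §6 p. 97.
* [Serre1979] J.-P. Serre, *Local Fields*, GTM 67 (1979), Ch. II §2 (ramification index), Ch. XIV §4.
-/

set_option autoImplicit false

noncomputable section

open Matrix NumberField IsDedekindDomain Polynomial
open scoped MatrixGroups WithZero

namespace Literature.NumberTheory.Rogawski1990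

open Literature.AlgebraicGeometry.ShimuraVarieties Literature.NumberTheory.Automorphic Literature.NumberTheory.Automorphic.UnitaryGroup
open Literature.NumberTheory.GaloisRepresentations Literature.NumberTheory.Automorphic.MoebiusShift

section CM

variable (L : Type) [Field L] [NumberField L] [IsCMField L] (v : HeightOneSpectrum (𝓞 ↥(maximalRealSubfield L)))
  (w : PlacesOver L v) (hw : IsCMField.complexConj L • w.1 = w.1)

omit [IsCMField L] in
/-- The local form of `Φ₂` over `E_v` is the literal `antidiag(1, 1)`. [cite: Rogawski1990, §3.5 p. 29] -/
private theorem antidiagTwo_map_algebraMap_ram :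
    (Matrix.of fun i j : Fin 2 => if i.val + j.val + 1 = 2 then (1 : L) else 0).map (algebraMap L (LocalRing L v)) =
      Matrix.of fun i j : Fin 2 => if i.val + j.val + 1 = 2 then (1 : LocalRing L v) else 0 := by
  ext i j
  simp only [map_apply, of_apply]
  split_ifs <;> simp

omit [IsCMField L] in
/-- An even non-positive `log`-valuation is `−2N`, `N : ℕ` (bookkeeping). [folklore] -/
private theorem exists_valued_eq_exp_neg_even_of_even {x : w.1.adicCompletion L} (hx0 : x ≠ 0) (heven : Even (WithZero.log (Valued.v x)))
    (hle : Valued.v x ≤ 1) : ∃ N : ℕ, Valued.v x = WithZero.exp (-((2 * N : ℕ) : ℤ)) := by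
  have hv0 : Valued.v x ≠ 0 := (Valuation.ne_zero_iff _).2 hx0
  have hle' : WithZero.log (Valued.v x) ≤ 0 := by
    rw [WithZero.log_le_iff_le_exp hv0, WithZero.exp_zero]; exact hle
  obtain ⟨k, hk⟩ := heven
  refine ⟨(-k).toNat, ?_⟩
  rw [← WithZero.exp_log hv0]
  congr 1
  push_cast
  rw [Int.toNat_of_nonneg (by omega)]
  omega

include hw in
set_option maxHeartbeats 400000 in
-- the CM local carriers are large terms
/-- **THE DISCRIMINANT OF THE IRREDUCIBLE UNITARY BLOCK HAS EVEN ORDER AND IS A NON-SQUARE AT A RAMIFIED PLACE.**  `γ_H = (g, u) ∈ H_v` at a non-split `v` (`w ∣ v`, `c • w = w`)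
RAMIFIED in `L` (`he : e(w|v) ≠ 1`) with `|2|_w = 1`, `χ_{g,w}` without a root in `L_w` (`hirr`), `tr g_w`, `det g_w` integral: `|tr² g_w − 4 det g_w|_w = exp(−2N)` for some
`N : ℕ`, and `tr² g_w − 4 det g_w` is not a square in `L_w` — the splitting field of `χ_{g,w}` is the UNRAMIFIED quadratic extension of `L_w` (the tame-ramified twin of ★
`exists_valued_disc_eq_exp_neg_odd_of_not_exists_isRoot`: `β₀²·disc = 4ι_v(k)` by ★ B-p14's `κ`, and `|ι_w k|_w = |k|_v²` is EVEN at a ramified `w`).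
[cite: Rogawski1990, §3.6 p. 31] [cite: Flicker1998UnitaryFL, §6 p. 97] [cite: Serre1979, Ch. II §2] -/
theorem exists_valued_disc_eq_exp_neg_even_of_not_exists_isRoot_ramified (he : v.asIdeal.ramificationIdx' w.1.asIdeal ≠ 1)
    (h2 : Valued.v (2 : w.1.adicCompletion L) = 1)
    {γH : (cmDatum L 2 (Matrix.of fun i j : Fin 2 => if i.val + j.val + 1 = 2 then (1 : L) else 0)).Local v ×
      (cmDatum L 1 (Matrix.of fun i j : Fin 1 => if i.val + j.val + 1 = 1 then (1 : L) else 0)).Local v}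
    (hirr : ¬ ∃ x : w.1.adicCompletion L, (((γH.1.val : GL (Fin 2) (LocalRing L v)).val.map
        (Pi.evalRingHom (fun w' : PlacesOver L v => w'.1.adicCompletion L) w)).charpoly).IsRoot x)
    (htr : Valued.v ((γH.1.val : GL (Fin 2) (LocalRing L v)).val.map
        (Pi.evalRingHom (fun w' : PlacesOver L v => w'.1.adicCompletion L) w)).trace ≤ 1)
    (hdet : Valued.v ((γH.1.val : GL (Fin 2) (LocalRing L v)).val.map
        (Pi.evalRingHom (fun w' : PlacesOver L v => w'.1.adicCompletion L) w)).det ≤ 1) :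
    (∃ N : ℕ, Valued.v (((γH.1.val : GL (Fin 2) (LocalRing L v)).val.map
        (Pi.evalRingHom (fun w' : PlacesOver L v => w'.1.adicCompletion L) w)).trace ^ 2 -
        4 * ((γH.1.val : GL (Fin 2) (LocalRing L v)).val.map
        (Pi.evalRingHom (fun w' : PlacesOver L v => w'.1.adicCompletion L) w)).det) =
      WithZero.exp (-((2 * N : ℕ) : ℤ))) ∧
    ¬ IsSquare ((((γH.1.val : GL (Fin 2) (LocalRing L v)).val.map
        (Pi.evalRingHom (fun w' : PlacesOver L v => w'.1.adicCompletion L) w)).trace ^ 2 -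
        4 * ((γH.1.val : GL (Fin 2) (LocalRing L v)).val.map
        (Pi.evalRingHom (fun w' : PlacesOver L v => w'.1.adicCompletion L) w)).det)) := by
  have hc1 : IsCMField.complexConj L ≠ 1 := IsCMField.complexConj_ne_one L
  haveI : Subsingleton (PlacesOver L v) := PlacesOver.subsingleton_of_smul_eq (IsCMField.complexConj L) hc1 w hw
  letI : Field (LocalRing L v) := (LocalRing.isField_of_smul_eq (IsCMField.complexConj L) hc1 w hw).toField
  haveI : NeZero (2 : w.1.adicCompletion L) := ⟨fun h => by rw [h, map_zero] at h2; exact zero_ne_one h2⟩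
  set ev := Pi.evalRingHom (fun w' : PlacesOver L v => w'.1.adicCompletion L) w with hev
  set A : Matrix (Fin 2) (Fin 2) (LocalRing L v) := (γH.1.val : GL (Fin 2) (LocalRing L v)).val with hAdef
  -- the non-square conjunct is immediate from `hirr` (`2 ≠ 0`)
  have hns : ¬ IsSquare ((A.map ev).trace ^ 2 - 4 * (A.map ev).det) := fun hsqD =>
    hirr ((exists_isRoot_charpoly_iff_isSquare_disc (A.map ev)).2 hsqD)
  refine ⟨?_, hns⟩
  -- `χ_A` has no root in `E_v` (a root `r` would give the root `r_w` of `χ_{g,w}`)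
  have hA : ∀ r : LocalRing L v, A.charpoly.eval r ≠ 0 := by
    intro r hr
    refine hirr ⟨r w, ?_⟩
    rw [Matrix.charpoly_map, Polynomial.IsRoot.def, Polynomial.eval_map]
    have h := Polynomial.eval₂_at_apply (p := A.charpoly) ev r
    rw [hr, map_zero] at h
    exact h
  -- the form `Φ₂` over `E_v`: hermitian, unit determinant, and `g` is unitary for it
  have hΦh : ((Matrix.of fun i j : Fin 2 => if i.val + j.val + 1 = 2 then (1 : LocalRing L v) else 0).map (conjLocal L (IsCMField.complexConj L) v))ᵀ =
      Matrix.of fun i j : Fin 2 => if i.val + j.val + 1 = 2 then (1 : LocalRing L v) else 0 := by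
    ext i j
    fin_cases i <;> fin_cases j <;> simp [Matrix.of_apply]
  have hΦd : IsUnit (Matrix.of fun i j : Fin 2 => if i.val + j.val + 1 = 2 then (1 : LocalRing L v) else 0).det := by
    rw [Matrix.det_fin_two]
    simp [Matrix.of_apply]
  have hAu : (A.map (conjLocal L (IsCMField.complexConj L) v))ᵀ * (Matrix.of fun i j : Fin 2 => if i.val + j.val + 1 = 2 then (1 : LocalRing L v) else 0) * A =
      Matrix.of fun i j : Fin 2 => if i.val + j.val + 1 = 2 then (1 : LocalRing L v) else 0 := by
    have h : (γH.1.val : GL (Fin 2) (LocalRing L v)) ∈ unitaryGroupOfForm (conjLocal L (IsCMField.complexConj L) v)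
        ((Matrix.of fun i j : Fin 2 => if i.val + j.val + 1 = 2 then (1 : L) else 0).map (algebraMap L (LocalRing L v))) := by
      rw [← local_eq_unitaryGroupOfForm_map]
      exact γH.1.property
    rw [antidiagTwo_map_algebraMap_ram] at h
    exact h
  -- B-p14's `κ = α₀ + β₀ g`, `κ² = ι_v(k)`, `ι_v(k)` not a square in `E_v`
  obtain ⟨δ, hδ0, hcδ, -⟩ := cmQuadraticGenerator_spec L
  obtain ⟨α₀, β₀, k, hβ₀, -, hsq, -⟩ :=
    exists_kappa_sq_eq_toLocalRing L v (IsCMField.complexConj L) hcδ hδ0 w hw hΦh hΦd hAu hA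
  -- `β₀² · disc χ_A = 4 ι_v(k)` in `E_v`, read at `w`
  have hdisc : β₀ ^ 2 * (A.trace ^ 2 - 4 * A.det) = 4 * toLocalRing L v k :=
    sq_mul_trace_sq_sub_four_mul_det_eq_of_kappa_sq hsq hβ₀ (ne_smul_one_of_eval_charpoly_ne_zero hA)
  have hdiscw : (β₀ w) ^ 2 * ((A.map ev).trace ^ 2 - 4 * (A.map ev).det) = 4 * UnitaryGroup.toPlace v w k := by
    have h := congrArg ev hdisc
    rw [map_mul, map_pow, map_sub, map_mul, map_pow, map_mul, AddMonoidHom.map_trace ev A, RingHom.map_det ev A] at h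
    simpa [hev] using h
  -- the RAMIFIED reading: `|ι_w(k)|_w = |k|_v²` has EVEN order
  set z : w.1.adicCompletion L := UnitaryGroup.toPlace v w k with hz
  have hzsq : Valued.v z = Valued.v k ^ 2 := valued_toPlace_eq_sq_of_ramified L v w hw he k
  set D := (A.map ev).trace ^ 2 - 4 * (A.map ev).det with hD
  have h4 : Valued.v (4 : w.1.adicCompletion L) = 1 := by
    rw [show (4 : w.1.adicCompletion L) = 2 * 2 by norm_num, map_mul, h2, one_mul]
  have h40 : (4 : w.1.adicCompletion L) ≠ 0 := fun h => by rw [h, map_zero] at h4; exact zero_ne_one h4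
  have hβw : β₀ w ≠ 0 := fun h0 => hβ₀ ((LocalRing.eq_iff_apply_eq (IsCMField.complexConj L) hc1 w hw β₀ 0).2 (by rw [h0]; rfl))
  have hD0 : D ≠ 0 := fun h0 => hns (by rw [h0]; exact ⟨0, (mul_zero 0).symm⟩)
  have hz0 : z ≠ 0 := by
    intro h0
    rw [h0, mul_zero] at hdiscw
    exact mul_ne_zero (pow_ne_zero 2 hβw) hD0 hdiscw
  have hvk : Valued.v k ≠ 0 := fun h0 => by
    rw [h0, zero_pow two_ne_zero] at hzsq
    exact hz0 ((Valuation.zero_iff _).1 hzsq)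
  have hvβ : Valued.v (β₀ w) ≠ 0 := (Valuation.ne_zero_iff _).2 hβw
  have hvD : Valued.v D ≠ 0 := (Valuation.ne_zero_iff _).2 hD0
  -- parity bookkeeping: `2 log v(β₀ w) + log v(D) = log v 4 + log v z = 2 log v(k)`
  have hlog : WithZero.log (Valued.v (β₀ w)) + WithZero.log (Valued.v (β₀ w)) + WithZero.log (Valued.v D) =
      WithZero.log (Valued.v k) + WithZero.log (Valued.v k) := by
    have h : WithZero.log (Valued.v (β₀ w ^ 2 * D)) = WithZero.log (Valued.v ((4 : w.1.adicCompletion L) * z)) := by rw [hdiscw]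
    rw [map_mul, map_mul, map_pow, h4, one_mul, hzsq, pow_two, pow_two, WithZero.log_mul (mul_ne_zero hvβ hvβ) hvD, WithZero.log_mul hvβ hvβ,
      WithZero.log_mul hvk hvk] at h
    exact h
  have hDeven : Even (WithZero.log (Valued.v D)) :=
    ⟨WithZero.log (Valued.v k) - WithZero.log (Valued.v (β₀ w)), by linarith⟩
  -- integrality of `D`
  have hDle : Valued.v D ≤ 1 := by
    refine (Valuation.map_sub _ _ _).trans (max_le ?_ ?_)
    · rw [map_pow]; exact pow_le_one₀ zero_le htr
    · rw [map_mul, h4, one_mul]; exact hdet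
  exact exists_valued_eq_exp_neg_even_of_even L v w hD0 hDeven hDle

/-! ## §3 (ED. 2) The square-distance form of the population guard (A-p12 (g23)'s WANT, ref5 (g4) R-222 (i)) -/

include hw in
set_option maxHeartbeats 400000 in
-- the CM local carriers are large terms
/-- **THE SAME, IN THE SQUARE-DISTANCE CURRENCY** of the ramified type-(2) clause's population guard (A-p12 (g23) (α₂) STUB A₂∕B₂, ref5 (g4) R-222 (i)): at a tame-ramified
non-split `w`, for rootless `χ_{g,w}` with integral `tr`, `det`: `∃ N : ℕ, |D|_w = exp(−2N) ∧ ∀ z, |D|_w ≤ |D − z²|_w`, `D = tr² g_w − 4 det g_w` — no element of `L_w` squares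
closer to `D` than `|D|` itself.  From the main theorem: if `|D − z²| < |D|` then `|z²| = |D|` and `D∕z² ≡ 1 (mod 𝔪_w)`, a square by Hensel at `|2|_w = 1` (★
`exists_sq_eq_of_valued_sub_one_lt`), contradicting `¬ IsSquare D`. [cite: Rogawski1990, §3.6 p. 31] [cite: Serre1979, Ch. II §2; Ch. XIV §4] -/
theorem exists_valued_disc_eq_exp_neg_even_sqDist_of_not_exists_isRoot_ramified (he : v.asIdeal.ramificationIdx' w.1.asIdeal ≠ 1)
    (h2 : Valued.v (2 : w.1.adicCompletion L) = 1)
    {γH : (cmDatum L 2 (Matrix.of fun i j : Fin 2 => if i.val + j.val + 1 = 2 then (1 : L) else 0)).Local v ×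
      (cmDatum L 1 (Matrix.of fun i j : Fin 1 => if i.val + j.val + 1 = 1 then (1 : L) else 0)).Local v}
    (hirr : ¬ ∃ x : w.1.adicCompletion L, (((γH.1.val : GL (Fin 2) (LocalRing L v)).val.map
        (Pi.evalRingHom (fun w' : PlacesOver L v => w'.1.adicCompletion L) w)).charpoly).IsRoot x)
    (htr : Valued.v ((γH.1.val : GL (Fin 2) (LocalRing L v)).val.map
        (Pi.evalRingHom (fun w' : PlacesOver L v => w'.1.adicCompletion L) w)).trace ≤ 1)
    (hdet : Valued.v ((γH.1.val : GL (Fin 2) (LocalRing L v)).val.map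
        (Pi.evalRingHom (fun w' : PlacesOver L v => w'.1.adicCompletion L) w)).det ≤ 1) :
    ∃ N : ℕ, Valued.v (((γH.1.val : GL (Fin 2) (LocalRing L v)).val.map
        (Pi.evalRingHom (fun w' : PlacesOver L v => w'.1.adicCompletion L) w)).trace ^ 2 -
        4 * ((γH.1.val : GL (Fin 2) (LocalRing L v)).val.map
        (Pi.evalRingHom (fun w' : PlacesOver L v => w'.1.adicCompletion L) w)).det) =
      WithZero.exp (-((2 * N : ℕ) : ℤ)) ∧
      ∀ z : w.1.adicCompletion L,
        Valued.v (((γH.1.val : GL (Fin 2) (LocalRing L v)).val.map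
          (Pi.evalRingHom (fun w' : PlacesOver L v => w'.1.adicCompletion L) w)).trace ^ 2 -
          4 * ((γH.1.val : GL (Fin 2) (LocalRing L v)).val.map
          (Pi.evalRingHom (fun w' : PlacesOver L v => w'.1.adicCompletion L) w)).det) ≤
        Valued.v ((((γH.1.val : GL (Fin 2) (LocalRing L v)).val.map
          (Pi.evalRingHom (fun w' : PlacesOver L v => w'.1.adicCompletion L) w)).trace ^ 2 -
          4 * ((γH.1.val : GL (Fin 2) (LocalRing L v)).val.map
          (Pi.evalRingHom (fun w' : PlacesOver L v => w'.1.adicCompletion L) w)).det) - z ^ 2) := by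
  obtain ⟨⟨N, hN⟩, hns⟩ := exists_valued_disc_eq_exp_neg_even_of_not_exists_isRoot_ramified L v w hw he h2 hirr htr hdet
  set D := ((γH.1.val : GL (Fin 2) (LocalRing L v)).val.map
      (Pi.evalRingHom (fun w' : PlacesOver L v => w'.1.adicCompletion L) w)).trace ^ 2 -
      4 * ((γH.1.val : GL (Fin 2) (LocalRing L v)).val.map
      (Pi.evalRingHom (fun w' : PlacesOver L v => w'.1.adicCompletion L) w)).det with hDdef
  refine ⟨N, hN, fun z => ?_⟩
  by_contra hlt
  rw [not_le] at hlt
  have hvD0 : Valued.v D ≠ 0 := by rw [hN]; exact WithZero.exp_ne_zero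
  have hD0 : D ≠ 0 := (Valuation.ne_zero_iff _).1 hvD0
  -- `|D − z²| < |D|` forces `|z²| = |D|`
  have hz2 : Valued.v (z ^ 2) = Valued.v D := by
    have h : Valued.v (z ^ 2 - D) < Valued.v D := by rw [← Valuation.map_neg, neg_sub]; exact hlt
    exact Valuation.map_eq_of_sub_lt _ h
  have hz20 : z ^ 2 ≠ 0 := fun h0 => hvD0 (by rw [← hz2, h0, map_zero])
  -- `q := D ∕ z²` is `≡ 1 (mod 𝔪_w)`, hence a square (Hensel, `|2|_w = 1`)
  have hq : Valued.v (D / z ^ 2 - 1) < 1 := by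
    have e : D / z ^ 2 - 1 = (D - z ^ 2) / z ^ 2 := by rw [sub_div D (z ^ 2) (z ^ 2), div_self hz20]
    rw [e, map_div₀, hz2, div_lt_one₀ (zero_lt_iff.2 hvD0)]
    exact hlt
  obtain ⟨s, hs, -⟩ := exists_sq_eq_of_valued_sub_one_lt w.1 h2 (D / z ^ 2) hq
  exact hns ⟨s * z, by rw [← pow_two, mul_pow, hs, div_mul_cancel₀ D hz20]⟩

/-! ## §4 (ED. 3) The unit part of the discriminant is a residue NON-square (A-p19 (g26)'s «want residue» 22:05:25Z — the `θ² = jε` datum of the (e2)(b) layers) -/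

section UnitPart

open scoped ValuativeRel

include hw in
set_option maxHeartbeats 400000 in
-- the CM local carriers are large terms
/-- **THE UNIT PART OF `D = tr² g_w − 4 det g_w` IS A RESIDUE NON-SQUARE** (the (e2)(b)-layer currency of A-p19 (g26), ★ `QuadraticUnramifiedOrderUnitIndex`'s token
`hns : ∀ b, IsUnit (b * b − k)`): at a tame-ramified non-split `w` with `|2|_w = 1`, for a uniformizer `ϖ` of `L_w` (`|ϖ|_w = exp(−1)`) and rootless `χ_{g,w}` with
integral `tr`, `det`, there are `N : ℕ` and `ε₀ ∈ 𝒪_w^×` with `D = ϖ^{2N}·ε₀`, `b² − ε₀ ∈ 𝒪_w^×` for every `b ∈ 𝒪_w`, i.e. `ε̄₀ ∉ 𝓀_w^{×2}` — the eigen-field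
`L_w(√D) = L_w(√ε₀)` is the UNRAMIFIED quadratic extension.  From §3: `ε₀ := D∕ϖ^{2N}` has `|ε₀| = 1`, and `|b² − ε₀| < 1` would give `|D − (ϖ^N b)²| =
|ϖ^{2N}|·|ε₀ − b²| < |D|`, against the square-distance form.  (`𝒪[L_w]` is the `ValuativeRel` valuation ring of `L_w`, ★ `instValuativeRelAdicCompletion`.)
[cite: Rogawski1990, §3.6 p. 31] [cite: Serre1979, Ch. II §2; Ch. XIV §4] -/
theorem exists_unitPart_disc_nonsquare_of_not_exists_isRoot_ramified (he : v.asIdeal.ramificationIdx' w.1.asIdeal ≠ 1)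
    (h2 : Valued.v (2 : w.1.adicCompletion L) = 1)
    (ϖ : w.1.adicCompletion L) (hϖ : Valued.v ϖ = WithZero.exp (-1 : ℤ))
    {γH : (cmDatum L 2 (Matrix.of fun i j : Fin 2 => if i.val + j.val + 1 = 2 then (1 : L) else 0)).Local v ×
      (cmDatum L 1 (Matrix.of fun i j : Fin 1 => if i.val + j.val + 1 = 1 then (1 : L) else 0)).Local v}
    (hirr : ¬ ∃ x : w.1.adicCompletion L, (((γH.1.val : GL (Fin 2) (LocalRing L v)).val.map
        (Pi.evalRingHom (fun w' : PlacesOver L v => w'.1.adicCompletion L) w)).charpoly).IsRoot x)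
    (htr : Valued.v ((γH.1.val : GL (Fin 2) (LocalRing L v)).val.map
        (Pi.evalRingHom (fun w' : PlacesOver L v => w'.1.adicCompletion L) w)).trace ≤ 1)
    (hdet : Valued.v ((γH.1.val : GL (Fin 2) (LocalRing L v)).val.map
        (Pi.evalRingHom (fun w' : PlacesOver L v => w'.1.adicCompletion L) w)).det ≤ 1) :
    ∃ N : ℕ, ∃ ε₀ : 𝒪[w.1.adicCompletion L],
      Valued.v (ε₀ : w.1.adicCompletion L) = 1 ∧
      (((γH.1.val : GL (Fin 2) (LocalRing L v)).val.map
        (Pi.evalRingHom (fun w' : PlacesOver L v => w'.1.adicCompletion L) w)).trace ^ 2 -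
        4 * ((γH.1.val : GL (Fin 2) (LocalRing L v)).val.map
        (Pi.evalRingHom (fun w' : PlacesOver L v => w'.1.adicCompletion L) w)).det) = ϖ ^ (2 * N) * (ε₀ : w.1.adicCompletion L) ∧
      (∀ b : 𝒪[w.1.adicCompletion L], IsUnit (b * b - ε₀)) ∧
      ¬ IsSquare (IsLocalRing.residue 𝒪[w.1.adicCompletion L] ε₀) := by
  classical
  obtain ⟨N, hN, hdist⟩ :=
    exists_valued_disc_eq_exp_neg_even_sqDist_of_not_exists_isRoot_ramified L v w hw he h2 hirr htr hdet
  set D := (((γH.1.val : GL (Fin 2) (LocalRing L v)).val.map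
        (Pi.evalRingHom (fun w' : PlacesOver L v => w'.1.adicCompletion L) w)).trace ^ 2 -
        4 * ((γH.1.val : GL (Fin 2) (LocalRing L v)).val.map
        (Pi.evalRingHom (fun w' : PlacesOver L v => w'.1.adicCompletion L) w)).det) with hDdef
  -- valuations of `ϖ^{2N}` and of the unit part `ε := D ∕ ϖ^{2N}`
  have hϖv0 : Valued.v ϖ ≠ 0 := by rw [hϖ]; exact WithZero.exp_ne_zero
  have hϖ0 : ϖ ≠ 0 := (Valuation.ne_zero_iff _).1 hϖv0
  have hpow0 : ϖ ^ (2 * N) ≠ 0 := pow_ne_zero _ hϖ0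
  have hϖN : Valued.v (ϖ ^ (2 * N)) = WithZero.exp (-((2 * N : ℕ) : ℤ)) := by
    rw [map_pow, hϖ, ← WithZero.exp_nsmul, smul_neg, nsmul_eq_mul, mul_one]
  have hvDϖ : Valued.v D = Valued.v (ϖ ^ (2 * N)) := by rw [hN, hϖN]
  have hvpow0 : Valued.v (ϖ ^ (2 * N)) ≠ 0 := by rw [hϖN]; exact WithZero.exp_ne_zero
  have hεv : Valued.v (D / ϖ ^ (2 * N)) = 1 := by rw [map_div₀, hvDϖ, div_self hvpow0]
  have hεO : D / ϖ ^ (2 * N) ∈ 𝒪[w.1.adicCompletion L] := (v_le_one_iff_mem_integer _).1 hεv.le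
  -- name the unit part as an element of `𝒪_w`
  obtain ⟨ε₀, hε₀⟩ : ∃ ε₀ : 𝒪[w.1.adicCompletion L], (ε₀ : w.1.adicCompletion L) = D / ϖ ^ (2 * N) := ⟨⟨_, hεO⟩, rfl⟩
  have hDε : D = ϖ ^ (2 * N) * (ε₀ : w.1.adicCompletion L) := by
    rw [hε₀, mul_comm (ϖ ^ (2 * N)) (D / ϖ ^ (2 * N)), div_mul_cancel₀ D hpow0]
  -- units of `𝒪_w` are the elements of valuation `1`
  have hunit : ∀ x : 𝒪[w.1.adicCompletion L], IsUnit x ↔ Valued.v (x : w.1.adicCompletion L) = 1 := fun x => by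
    rw [(Valuation.integer.integers (ValuativeRel.valuation (w.1.adicCompletion L))).isUnit_iff_valuation_eq_one,
      v_eq_one_iff_valuation_eq_one]; rfl
  -- `b² − ε₀` is a unit for every integer `b` (else `(ϖ^N b)²` is closer to `D` than `|D|`, against §3)
  have hunits : ∀ b : 𝒪[w.1.adicCompletion L], IsUnit (b * b - ε₀) := by
    intro b
    by_contra hnu
    have hle : Valued.v (((b * b - ε₀ : 𝒪[w.1.adicCompletion L]) : w.1.adicCompletion L)) ≤ 1 :=
      (v_le_one_iff_mem_integer _).2 (b * b - ε₀).2
    have hlt : Valued.v ((b : w.1.adicCompletion L) * b - ε₀) < 1 := by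
      have h := lt_of_le_of_ne hle (fun h1 => hnu ((hunit _).2 h1))
      push_cast at h
      exact h
    have hDz : D - (ϖ ^ N * (b : w.1.adicCompletion L)) ^ 2 =
        ϖ ^ (2 * N) * ((ε₀ : w.1.adicCompletion L) - (b : w.1.adicCompletion L) * b) := by
      rw [hDε]; ring
    have hlt' : Valued.v (D - (ϖ ^ N * (b : w.1.adicCompletion L)) ^ 2) < Valued.v D := by
      rw [hDz, map_mul, hvDϖ, Valuation.map_sub_swap]
      exact mul_lt_of_lt_one_right (zero_lt_iff.2 hvpow0) hlt
    exact absurd hlt' (not_lt.2 (hdist (ϖ ^ N * (b : w.1.adicCompletion L))))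
  refine ⟨N, ε₀, hε₀ ▸ hεv, hDε, hunits, ?_⟩
  -- … equivalently `ε̄₀` is a non-square of the residue field
  rintro ⟨r, hr⟩
  obtain ⟨b, rfl⟩ := Ideal.Quotient.mk_surjective r
  have hmem : b * b - ε₀ ∈ IsLocalRing.maximalIdeal 𝒪[w.1.adicCompletion L] := by
    rw [← IsLocalRing.residue_eq_zero_iff, map_sub, map_mul, sub_eq_zero]
    exact hr.symm
  exact ((IsLocalRing.mem_maximalIdeal _).1 hmem) (hunits b)

end UnitPart

/-! ## §5 (ED. 4) The rider `1 ≤ N`: a 1-DEEP element has discriminant depth `≥ 1` (A-p12 (g23) (α₂) v0.4: the rows keep `1 ≤ N →`; place-generic, no `he`∕`h2`∕`hirr`) -/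

omit [IsCMField L] in
/-- **A 1-deep `2 × 2` matrix has `|tr² − 4 det| < 1`**: if every entry of `M − 1` has valuation `< 1` then, writing `tr² M − 4 det M = (M₀₀ − M₁₁)² + (2M₀₁)(2M₁₀)` with
`M₀₀ − M₁₁ = (M₀₀ − 1) − (M₁₁ − 1)` and `|2| ≤ 1`, the discriminant of `χ_M` lies in `𝔪_w` (ultrametric inequality only). [cite: Rogawski1990, §3.6 p. 31] [cite: Serre1979, Ch. II §2] -/
theorem valued_trace_sq_sub_four_det_lt_one_of_forall_valued_sub_one_lt (M : Matrix (Fin 2) (Fin 2) (w.1.adicCompletion L))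
    (h1 : ∀ a b : Fin 2, Valued.v (M a b - (1 : Matrix (Fin 2) (Fin 2) (w.1.adicCompletion L)) a b) < 1) :
    Valued.v (M.trace ^ 2 - 4 * M.det) < 1 := by
  have h00 : Valued.v (M 0 0 - 1) < 1 := by simpa using h1 0 0
  have h11 : Valued.v (M 1 1 - 1) < 1 := by simpa using h1 1 1
  have h01 : Valued.v (M 0 1) < 1 := by simpa using h1 0 1
  have h10 : Valued.v (M 1 0) < 1 := by simpa using h1 1 0
  have h2le : Valued.v (2 : w.1.adicCompletion L) ≤ 1 := by
    rw [← one_add_one_eq_two]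
    exact Valuation.map_add_le _ (le_of_eq (map_one _)) (le_of_eq (map_one _))
  have hmul2 : ∀ x : w.1.adicCompletion L, Valued.v x < 1 → Valued.v (2 * x) < 1 := fun x hx => by
    rw [map_mul]
    exact (mul_le_of_le_one_left' h2le).trans_lt hx
  have hD : M.trace ^ 2 - 4 * M.det = ((M 0 0 - 1) - (M 1 1 - 1)) * ((M 0 0 - 1) - (M 1 1 - 1)) + (2 * M 0 1) * (2 * M 1 0) := by
    rw [Matrix.trace_fin_two, Matrix.det_fin_two]; ring
  rw [hD]
  refine Valuation.map_add_lt _ ?_ ?_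
  · rw [map_mul]
    exact (mul_le_of_le_one_right' (Valuation.map_sub_lt _ h00 h11).le).trans_lt (Valuation.map_sub_lt _ h00 h11)
  · rw [map_mul]
    exact (mul_le_of_le_one_right' (hmul2 _ h10).le).trans_lt (hmul2 _ h01)

/-- **THE RIDER `1 ≤ N`** for the (α₂) depth token: if `γ_H`'s `2 × 2` block at `w` is 1-deep (`|g_w − 1|_{ab} < 1` entrywise — a fortiori on the 2-deep tube `K_H(ϖ_v)`, ★ (I)
`forall_valued_blocks_sub_one_le_of_endoEmbLocal` for the `endoEmbLocal` spelling) and `|tr² g_w − 4 det g_w|_w = exp(−2N)`, then `1 ≤ N` — the depth the population guard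
produces near `1` is positive, so the `1 ≤ N →` rows of the type-(2) clause apply to every `γ_H ∈ V`. [cite: Rogawski1990, §3.6 p. 31] [cite: Serre1979, Ch. II §2] -/
theorem one_le_of_valued_disc_eq_exp_neg_even_of_forall_valued_sub_one_lt
    {γH : (cmDatum L 2 (Matrix.of fun i j : Fin 2 => if i.val + j.val + 1 = 2 then (1 : L) else 0)).Local v ×
      (cmDatum L 1 (Matrix.of fun i j : Fin 1 => if i.val + j.val + 1 = 1 then (1 : L) else 0)).Local v}
    (h1 : ∀ a b : Fin 2, Valued.v (((γH.1.val : GL (Fin 2) (LocalRing L v)).val.map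
        (Pi.evalRingHom (fun w' : PlacesOver L v => w'.1.adicCompletion L) w)) a b - (1 : Matrix (Fin 2) (Fin 2) (w.1.adicCompletion L)) a b) < 1)
    {N : ℕ} (hN : Valued.v (((γH.1.val : GL (Fin 2) (LocalRing L v)).val.map
        (Pi.evalRingHom (fun w' : PlacesOver L v => w'.1.adicCompletion L) w)).trace ^ 2 -
        4 * ((γH.1.val : GL (Fin 2) (LocalRing L v)).val.map
        (Pi.evalRingHom (fun w' : PlacesOver L v => w'.1.adicCompletion L) w)).det) =
      WithZero.exp (-((2 * N : ℕ) : ℤ))) : 1 ≤ N := by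
  have hlt := valued_trace_sq_sub_four_det_lt_one_of_forall_valued_sub_one_lt L v w _ h1
  rw [hN, ← WithZero.exp_zero, WithZero.exp_lt_exp] at hlt
  omega

/-! ## §6 (ED. 4) COMPANION (ref5 (g4) R-261): at a ramified place the discriminant of EVERY regular `γ_H` has EVEN `w`-order — no `hirr`, no `|2| = 1` -/

omit [IsCMField L] in
/-- The local form of `Φ₂` over `E_v` has determinant `−1`. [cite: Rogawski1990, §3.5 p. 29] -/
private theorem det_antidiagTwo_ram :
    (Matrix.of fun i j : Fin 2 => if i.val + j.val + 1 = 2 then (1 : LocalRing L v) else 0).det = -1 := by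
  rw [Matrix.det_fin_two]
  simp [Matrix.of_apply]

include hw in
set_option maxHeartbeats 400000 in
-- the CM local carriers are large terms
/-- **EVEN DISCRIMINANT ORDER FOR EVERY REGULAR `γ_H` AT A RAMIFIED PLACE** (companion of §2, ref5 (g4) R-261 — no `hirr`, no `|2|_w = 1`): for `γ_H = (g, u) ∈ H_v` with
`g_w` integral (`|tr g_w|, |det g_w| ≤ 1`) and `D := tr² g_w − 4 det g_w ≠ 0`, `∃ N : ℕ, |D|_w = exp(−2N)`.  Unitarity `ᵗḡ Φ₂ g = Φ₂` over `E_v` gives `σ(det g)·det g = 1` and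
`det g·σ(tr g) = tr g` (the `2 × 2` identity `g⁻¹ = Φ₂ ᵗḡ Φ₂`, `tr g⁻¹·det g = tr g`), hence `D = det g·(tr g·σ(tr g) − 4)` with the second factor `σ`-FIXED, i.e. in `ι_v(L⁺_v)`
(★ `Liu2021.LemD1OfPlace.exists_toLocalRing_eq_of_conjLocal_eq`); at the ramified `w`, `|det g_w| = 1` (`σ_w` isometric) and `|ι_w(p)|_w = |p|_v²` (★ `valued_toPlace_eq_sq_of_ramified`),
so `log |D|_w` is even; integrality makes it `−2N`.  With §5 this lets the (α₂) `_of_coeff` head `obtain ⟨N, hN⟩` and `1 ≤ N` for every regular `γ_H` in the 1-deep ball.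
[cite: Rogawski1990, §3.6 p. 31; §3.5 p. 29] [cite: Serre1979, Ch. II §2] -/
theorem exists_valued_disc_eq_exp_neg_even_of_ne_zero_ramified (he : v.asIdeal.ramificationIdx' w.1.asIdeal ≠ 1)
    {γH : (cmDatum L 2 (Matrix.of fun i j : Fin 2 => if i.val + j.val + 1 = 2 then (1 : L) else 0)).Local v ×
      (cmDatum L 1 (Matrix.of fun i j : Fin 1 => if i.val + j.val + 1 = 1 then (1 : L) else 0)).Local v}
    (htr : Valued.v ((γH.1.val : GL (Fin 2) (LocalRing L v)).val.map
        (Pi.evalRingHom (fun w' : PlacesOver L v => w'.1.adicCompletion L) w)).trace ≤ 1)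
    (hdet : Valued.v ((γH.1.val : GL (Fin 2) (LocalRing L v)).val.map
        (Pi.evalRingHom (fun w' : PlacesOver L v => w'.1.adicCompletion L) w)).det ≤ 1)
    (hD0 : (((γH.1.val : GL (Fin 2) (LocalRing L v)).val.map
        (Pi.evalRingHom (fun w' : PlacesOver L v => w'.1.adicCompletion L) w)).trace ^ 2 -
        4 * ((γH.1.val : GL (Fin 2) (LocalRing L v)).val.map
        (Pi.evalRingHom (fun w' : PlacesOver L v => w'.1.adicCompletion L) w)).det) ≠ 0) :
    ∃ N : ℕ, Valued.v (((γH.1.val : GL (Fin 2) (LocalRing L v)).val.map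
        (Pi.evalRingHom (fun w' : PlacesOver L v => w'.1.adicCompletion L) w)).trace ^ 2 -
        4 * ((γH.1.val : GL (Fin 2) (LocalRing L v)).val.map
        (Pi.evalRingHom (fun w' : PlacesOver L v => w'.1.adicCompletion L) w)).det) = WithZero.exp (-((2 * N : ℕ) : ℤ)) := by
  have hc1 : IsCMField.complexConj L ≠ 1 := IsCMField.complexConj_ne_one L
  haveI : Subsingleton (PlacesOver L v) := PlacesOver.subsingleton_of_smul_eq (IsCMField.complexConj L) hc1 w hw
  obtain ⟨δ, hδ0, hcδ, -⟩ := cmQuadraticGenerator_spec L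
  set ev := Pi.evalRingHom (fun w' : PlacesOver L v => w'.1.adicCompletion L) w with hev
  set σ' := conjLocal L (IsCMField.complexConj L) v with hσ'
  have hσσ : ∀ x, σ' (σ' x) = x := conjLocal_conjLocal (IsCMField.complexConj L) v hcδ hδ0
  set A : Matrix (Fin 2) (Fin 2) (LocalRing L v) := (γH.1.val : GL (Fin 2) (LocalRing L v)).val with hAdef
  -- unitarity of `g` for `Φ₂ = antidiag(1, 1)` over `E_v`
  have hAu : (A.map σ')ᵀ * (Matrix.of fun i j : Fin 2 => if i.val + j.val + 1 = 2 then (1 : LocalRing L v) else 0) * A =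
      Matrix.of fun i j : Fin 2 => if i.val + j.val + 1 = 2 then (1 : LocalRing L v) else 0 := by
    have h : (γH.1.val : GL (Fin 2) (LocalRing L v)) ∈ unitaryGroupOfForm (conjLocal L (IsCMField.complexConj L) v)
        ((Matrix.of fun i j : Fin 2 => if i.val + j.val + 1 = 2 then (1 : L) else 0).map (algebraMap L (LocalRing L v))) := by
      rw [← local_eq_unitaryGroupOfForm_map]
      exact γH.1.property
    rw [antidiagTwo_map_algebraMap_ram] at h
    exact h
  -- the four entries of the unitarity relation: `σ(A₁ᵢ)·A₀ⱼ + σ(A₀ᵢ)·A₁ⱼ = (Φ₂)ᵢⱼ`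
  have e00 : σ' (A 1 0) * A 0 0 + σ' (A 0 0) * A 1 0 = 0 := by
    simpa [Matrix.mul_apply, Fin.sum_univ_two, Matrix.of_apply] using congrFun (congrFun hAu 0) 0
  have e01 : σ' (A 1 0) * A 0 1 + σ' (A 0 0) * A 1 1 = 1 := by
    simpa [Matrix.mul_apply, Fin.sum_univ_two, Matrix.of_apply] using congrFun (congrFun hAu 0) 1
  have e10 : σ' (A 1 1) * A 0 0 + σ' (A 0 1) * A 1 0 = 1 := by
    simpa [Matrix.mul_apply, Fin.sum_univ_two, Matrix.of_apply] using congrFun (congrFun hAu 1) 0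
  have e11 : σ' (A 1 1) * A 0 1 + σ' (A 0 1) * A 1 1 = 0 := by
    simpa [Matrix.mul_apply, Fin.sum_univ_two, Matrix.of_apply] using congrFun (congrFun hAu 1) 1
  -- `det g · σ(tr g) = tr g` and `σ(det g) · det g = 1`
  have hdt : A.det * σ' A.trace = A.trace := by
    rw [Matrix.trace_fin_two, Matrix.det_fin_two, map_add]
    linear_combination (A 1 1) * e10 + (A 0 0) * e01 - (A 1 0) * e11 - (A 0 1) * e00
  have hσd : σ' A.det * A.det = 1 := by
    have h := congrArg Matrix.det hAu
    rw [Matrix.det_mul, Matrix.det_mul, Matrix.det_transpose, det_antidiagTwo_ram, ← RingHom.mapMatrix_apply, ← RingHom.map_det] at h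
    linear_combination (-1 : LocalRing L v) * h
  -- `D = det g · (tr g·σ(tr g) − 4)` over `E_v`, the second factor `σ`-fixed, hence in `ι_v(L⁺_v)`
  have hfac : A.trace ^ 2 - 4 * A.det = A.det * (A.trace * σ' A.trace - 4) := by
    linear_combination (-A.trace) * hdt
  have hfix : σ' (A.trace * σ' A.trace - 4) = A.trace * σ' A.trace - 4 := by
    rw [map_sub, map_mul, hσσ, map_ofNat]; ring
  haveI : Algebra.IsQuadraticExtension ↥(maximalRealSubfield L) L := IsCMField.isQuadraticExtension L
  obtain ⟨p, hp⟩ := Liu2021.LemD1OfPlace.exists_toLocalRing_eq_of_conjLocal_eq L v (IsCMField.complexConj L) hcδ hδ0 _ hfix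
  -- read at `w`
  set D := (((γH.1.val : GL (Fin 2) (LocalRing L v)).val.map
        (Pi.evalRingHom (fun w' : PlacesOver L v => w'.1.adicCompletion L) w)).trace ^ 2 -
        4 * ((γH.1.val : GL (Fin 2) (LocalRing L v)).val.map
        (Pi.evalRingHom (fun w' : PlacesOver L v => w'.1.adicCompletion L) w)).det) with hDdef
  have hDw : D = (A.map ev).det * UnitaryGroup.toPlace v w p := by
    have h := congrArg ev hfac
    rw [map_sub, map_pow, map_mul, map_mul, AddMonoidHom.map_trace ev A, RingHom.map_det ev A, ← hp] at h
    simpa [hev] using h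
  have hσdw : galAdicCompletionMap (L := L) (IsCMField.complexConj L) hw ((A.map ev).det) * (A.map ev).det = 1 := by
    have h := congrArg ev hσd
    have h' : ev (σ' A.det) = galAdicCompletionMap (L := L) (IsCMField.complexConj L) hw (ev A.det) := by
      rw [hσ']
      exact conjLocal_apply_eq_of_smul_eq (IsCMField.complexConj L) hc1 v w hw A.det
    rw [map_mul, map_one, h', RingHom.map_det ev A] at h
    simpa [hev] using h
  -- valuations: `|det g_w| = 1`, `|ι_w p| = |p|_v²`
  have hvd : Valued.v ((A.map ev).det) = 1 := by
    have hv := congrArg Valued.v hσdw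
    rw [map_mul, valued_galAdicCompletionMap, map_one] at hv
    have h0 : Valued.v ((A.map ev).det) ≠ 0 := fun h0 => by rw [h0, zero_mul] at hv; exact zero_ne_one hv
    have hlog := congrArg WithZero.log hv
    rw [WithZero.log_mul h0 h0, WithZero.log_one] at hlog
    have hl0 : WithZero.log (Valued.v ((A.map ev).det)) = 0 := by omega
    rw [← WithZero.exp_log h0, hl0, WithZero.exp_zero]
  have hzsq : Valued.v (UnitaryGroup.toPlace v w p) = Valued.v p ^ 2 := valued_toPlace_eq_sq_of_ramified L v w hw he p
  have hz0 : UnitaryGroup.toPlace v w p ≠ 0 := fun h0 => hD0 (by rw [hDw, h0, mul_zero])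
  have hvp : Valued.v p ≠ 0 := fun h0 => by
    rw [h0, zero_pow two_ne_zero] at hzsq
    exact hz0 ((Valuation.zero_iff _).1 hzsq)
  -- parity and integrality
  have hDeven : Even (WithZero.log (Valued.v D)) := by
    refine ⟨WithZero.log (Valued.v p), ?_⟩
    rw [hDw, map_mul, hvd, one_mul, hzsq, pow_two, WithZero.log_mul hvp hvp]
  have h2le : Valued.v (2 : w.1.adicCompletion L) ≤ 1 := by
    rw [← one_add_one_eq_two]
    exact Valuation.map_add_le _ (le_of_eq (map_one _)) (le_of_eq (map_one _))
  have h4le : Valued.v (4 : w.1.adicCompletion L) ≤ 1 := by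
    rw [show (4 : w.1.adicCompletion L) = 2 * 2 by norm_num, map_mul]
    exact mul_le_one' h2le h2le
  have hDle : Valued.v D ≤ 1 := by
    refine (Valuation.map_sub _ _ _).trans (max_le ?_ ?_)
    · rw [map_pow]; exact pow_le_one₀ zero_le htr
    · rw [map_mul]; exact mul_le_one' h4le hdet
  exact exists_valued_eq_exp_neg_even_of_even L v w hD0 hDeven hDle

end CM

end Literature.NumberTheory.Rogawski1990

end
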